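import Literature.AlgebraicGeometry.Frobenioids.FinSubextCatGaloisCorrespondence
import Literature.AnabelianGeometry.SemiGraphs.CosetCategoriesBridge
import HarnessLib

/-!
# [IUTchI] Example 5.1 (i)/(ii): the number field «corresponding to `A`» on the SMALL coset model of `†𝒟^⊛ = ℬ(G_F)⁰` —
# the canonical Galois correspondence `CosetCat G_F ⥤ FinSubextCat F F̄`, `G_F/V ↦ Spec F̄^V`, and its comparison with the
# tree's correspondence through CHOSEN base points

S. Mochizuki, *Inter-universal Teichmüller theory I*, kurims manuscript (May 2020), §5 Example 5.1 (i) p. 123 l. 33–38 («write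
`†𝒟^⊛` for `ℬ(−)⁰` of this profinite group»), (ii) p. 125 («the number fields `𝕄̄^⊛(†𝒟^⊚)^A` [for `A ∈ Ob(†𝒟^⊛)`]»)
([IUTchI] Ex 5.1 (i) p.123) [claim: Mochizuki2012, status: disputed] (D-0012 claim key; nothing of the series is asserted; no
side taken on [IUTchIII] Cor. 3.12).  The mathematics is CLASSICAL (OURS): S. Mochizuki, *The geometry of Frobenioids I*, Kyushu
J. Math. **62** (2008), Example 6.3 p. 113 («`D = B(G)⁰` … `Spec(L)`, where `L ⊆ F̃` is a finite extension»)
[cite: MochizukiFrdI2008, Ex. 6.3 p.113]; *Frobenioids II*, Example 1.3 (i)–(iii) p. 11 (coset spaces `Π/Π°`)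
[cite: MochizukiFrdII2008, Ex 1.3 (i) p.11].

Cell abc-iut, seat abc-iut-L5-t4 gen 9, row «HBCIRC-CARRIER» (census item (⊚-3) of abc-iut-L5-lead RULINGS #182/#185), FILE A of 2.
DEF-LIGHT: two `def`s (`cosetFixedObj`, `cosetFixedSubext`); everything else is a theorem; 0 instance · 0 notation · no Prop fact.
* §0 coset arithmetic in `CosetCat G` (representatives of points; an object isomorphic to a NORMAL object `G/N` IS `G/N`);
* §1 **`cosetFixedSubext F : CosetCat G_F ⥤ FinSubextCat F F̄`**, `G_F/V ↦ Spec F̄^V`, arrow with point `g·V'` ↦ `(a ↦ g a)` — the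
  Galois correspondence of [FrdI] Ex. 6.3 with the CANONICAL base point `1·V` (pattern of `GaloisValDatum.fieldFunctor`,
  `GaloisCosetFields.lean`, for `G_F` in place of `Gal(k̄/k)` and intermediate fields of `F̄` in place of valued fields);
* §2 **`nonempty_toConnected_galoisSubext_iso_cosetFixedSubext`**: the tree's correspondence through `Classical`-chosen base points,
  `CosetCat.toConnected ⋙ galoisSubext F` (`G_F/V ↦ Spec F̄^{Stab(x_V)} = Spec F̄^{g_V V g_V⁻¹}`, `FinSubextCatGaloisCorrespondence.lean`),
  is naturally ISOMORPHIC to `cosetFixedSubext F` (components `a ↦ g_V a`; pattern of ★ `GaloisValDatumGenuineBaseIso`).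
Consumer: FILE B `GlobalFrobenioidsPushCarrierGaloisRich.lean` (the push carrier `ℬ(H)⁰ → ℬ(G_F)⁰` of an open `ι : H → G_F` is
Galois-rich up to isomorphism — abc-iut-L5-t11's binder `hS` of ★ `Cor53.fcirc_rigidOverBase_of_galoisRich`).
HONEST TAGS: classical lemmas about OUR model categories; typed ≠ inhabited ≠ proved; nothing here asserts abc proved or refuted.
-/

noncomputable section

namespace Literature.IUT.HodgeTheaters

open CategoryTheory Literature.AlgebraicGeometry.Frobenioids Literature.AnabelianGeometry.SemiGraphs
open Literature.AlgebraicGeometry.Frobenioids.QuasiTemperoid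

namespace PushCarrier

/-! ### §0 Coset arithmetic in `CosetCat` (representatives of points; normal objects) -/

section Coset

variable {G : Type} [Group G] [TopologicalSpace G]

/-- If `g` represents the point of `f : G/U → G/V`, then `g⁻¹ U g ⊆ V`. [cite: MochizukiFrdII2008, Ex 1.3 (ii) p.11] -/
theorem conj_mem_of_rep_pt {X Y : CosetCat G} (f : X ⟶ Y) {g : G} (hg : (g : Y.carrier) = CosetCat.pt f)
    {σ : G} (hσ : σ ∈ X.sg) : g⁻¹ * σ * g ∈ Y.sg := by
  have h := CosetCat.smul_pt f (inv_mem hσ)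
  rw [← hg, MulAction.Quotient.smul_coe, smul_eq_mul, QuotientGroup.eq, mul_inv_rev, inv_inv] at h
  exact h

/-- Along `f : G/U → G/V` with `V` NORMAL: `U ≤ V`. [cite: MochizukiFrdII2008, Ex 1.3 (ii) p.11] -/
theorem mem_of_hom_of_normal_right {X Y : CosetCat G} (f : X ⟶ Y) (hY : (Y.sg : Subgroup G).Normal)
    {σ : G} (hσ : σ ∈ X.sg) : σ ∈ Y.sg := by
  obtain ⟨g, hg⟩ := QuotientGroup.mk_surjective (CosetCat.pt f)
  have h := hY.conj_mem _ (conj_mem_of_rep_pt f hg hσ) g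
  rwa [show g * (g⁻¹ * σ * g) * g⁻¹ = σ by group] at h

/-- Along `f : G/U → G/V` with `U` NORMAL: `U ≤ V`. [cite: MochizukiFrdII2008, Ex 1.3 (ii) p.11] -/
theorem mem_of_hom_of_normal_left {X Y : CosetCat G} (f : X ⟶ Y) (hX : (X.sg : Subgroup G).Normal)
    {σ : G} (hσ : σ ∈ X.sg) : σ ∈ Y.sg := by
  obtain ⟨g, hg⟩ := QuotientGroup.mk_surjective (CosetCat.pt f)
  have h := conj_mem_of_rep_pt f hg (hX.conj_mem _ hσ g)
  rwa [show g⁻¹ * (g * σ * g⁻¹) * g = σ by group] at h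

/-- An object ISOMORPHIC to a NORMAL object `G/N` IS `G/N` (conjugate subgroups). [cite: MochizukiFrdII2008, Ex 1.3 (i) p.11] -/
theorem mem_sg_iff_of_iso_normal {X Y : CosetCat G} (e : X ≅ Y) (hY : (Y.sg : Subgroup G).Normal) (σ : G) :
    σ ∈ X.sg ↔ σ ∈ Y.sg :=
  ⟨mem_of_hom_of_normal_right e.hom hY, fun h => mem_of_hom_of_normal_left e.inv hY h⟩

/-- … so its subgroup is normal too. [cite: MochizukiFrdII2008, Ex 1.3 (i) p.11] -/
theorem normal_of_iso_normal {X Y : CosetCat G} (e : X ≅ Y) (hY : (Y.sg : Subgroup G).Normal) :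
    (X.sg : Subgroup G).Normal :=
  ⟨fun n hn g => (mem_sg_iff_of_iso_normal e hY _).mpr (hY.conj_mem n ((mem_sg_iff_of_iso_normal e hY n).mp hn) g)⟩

/-- In a NORMAL object `G/N` every coset `h·N` is `N`-fixed (`1·N ↦ h·N` is a morphism). [cite: MochizukiFrdII2008, Ex 1.3 (i) p.11] -/
theorem smul_coe_eq_of_normal (X : CosetCat G) (hX : (X.sg : Subgroup G).Normal) (h : G) :
    ∀ u ∈ X.sg, u • (h : X.carrier) = (h : X.carrier) := by
  intro u hu
  rw [MulAction.Quotient.smul_coe, smul_eq_mul, QuotientGroup.eq, mul_inv_rev]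
  have := hX.conj_mem _ (inv_mem hu) h⁻¹
  rwa [inv_inv] at this

end Coset

end PushCarrier

/-! ### §1 The canonical small-model Galois correspondence `CosetCat G_F ⥤ FinSubextCat F F̄`, `V ↦ Spec F̄^V` -/

section FixedSubext

variable (F : Type) [Field F] [PerfectField F]

/-- `F̄^V` is FINITE over `F` for `V ⊆ G_F` OPEN (Krull: `V` closed, `Gal(F̄/F̄^V) = V`). [cite: MochizukiFrdI2008, Ex. 6.3 p.113] -/
theorem PushCarrier.finiteDimensional_fixedField_openSubgroup (V : OpenSubgroup (GalFbar F)) :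
    FiniteDimensional F (IntermediateField.fixedField (V : Subgroup (GalFbar F))) := by
  haveI : IsGalois F (Fbar F) := {}
  refine (InfiniteGalois.isOpen_iff_finite _).mp ?_
  rw [InfiniteGalois.fixingSubgroup_fixedField ⟨(V : Subgroup (GalFbar F)), V.isClosed⟩]
  exact V.isOpen

/-- The object `Spec F̄^V` of `FinSubextCat F F̄` attached to `G_F/V` (CANONICAL base point `1·V`). [cite: MochizukiFrdI2008, Ex. 6.3 p.113] -/
def cosetFixedObj (X : CosetCat (GalFbar F)) : FinSubextCat F (Fbar F) :=
  @FinSubextCat.mk F _ (Fbar F) _ _ (IntermediateField.fixedField (X.sg : Subgroup (GalFbar F)))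
    (PushCarrier.finiteDimensional_fixedField_openSubgroup F X.sg)

/-- Its field is `F̄^V`. [cite: MochizukiFrdI2008, Ex. 6.3 p.113] -/
theorem cosetFixedObj_L (X : CosetCat (GalFbar F)) :
    (cosetFixedObj F X).L = IntermediateField.fixedField (X.sg : Subgroup (GalFbar F)) := rfl

variable {F}

/-- Any representative `g` of the point of `f : G_F/U → G_F/V` maps `F̄^V` into `F̄^U` (`g⁻¹ U g ⊆ V`).
[cite: MochizukiFrdI2008, Ex. 6.3 p.113] -/
theorem PushCarrier.rep_apply_mem {X Y : CosetCat (GalFbar F)} (f : X ⟶ Y) {g : GalFbar F}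
    (hg : (g : Y.carrier) = CosetCat.pt f) {a : Fbar F} (ha : a ∈ (cosetFixedObj F Y).L) :
    g a ∈ (cosetFixedObj F X).L :=
  apply_mem_fixedField_of_conj_mem (fun _ hσ => PushCarrier.conj_mem_of_rep_pt f hg hσ) ha

/-- Two representatives of the point act identically on `F̄^V`. [cite: MochizukiFrdI2008, Ex. 6.3 p.113] -/
theorem PushCarrier.rep_apply_eq {X Y : CosetCat (GalFbar F)} (f : X ⟶ Y) {g g' : GalFbar F}
    (hg : (g : Y.carrier) = CosetCat.pt f) (hg' : (g' : Y.carrier) = CosetCat.pt f)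
    {a : Fbar F} (ha : a ∈ (cosetFixedObj F Y).L) : g' a = g a :=
  apply_eq_apply_of_inv_mul_mem (QuotientGroup.eq.mp (hg.trans hg'.symm)) ha

/-- The chosen representative `out(pt f)` represents the point. [cite: MochizukiFrdII2008, Ex 1.3 (i) p.11] -/
theorem PushCarrier.out_pt_coe {G : Type} [Group G] [TopologicalSpace G] {X Y : CosetCat G} (f : X ⟶ Y) :
    ((Quotient.out (CosetCat.pt f) : G) : Y.carrier) = CosetCat.pt f :=
  QuotientGroup.out_eq' _

variable (F)

/-- **The canonical Galois correspondence on the small coset model**, `CosetCat G_F ⥤ FinSubextCat F F̄`: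
`G_F/V ↦ Spec F̄^V`, and `(f : G_F/U → G_F/V, 1·U ↦ g·V) ↦ (F̄^V → F̄^U, a ↦ g a)` ([FrdI] Ex. 6.3 "`Spec(L)`";
[FrdII] Ex. 1.3 (iii) "[cf. Example 1.1, (ii)]"; base point = the identity coset, no choice beyond a representative of
`g·V`, on which the map does not depend, `cosetFixedSubext_map_apply`). [cite: MochizukiFrdI2008, Ex. 6.3 p.113] -/
def cosetFixedSubext : CosetCat (GalFbar F) ⥤ FinSubextCat F (Fbar F) where
  obj := cosetFixedObj F
  map f := ⟨restrictBetween (Quotient.out (CosetCat.pt f)) _ _ fun _ ha =>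
    PushCarrier.rep_apply_mem f (PushCarrier.out_pt_coe f) ha⟩
  map_id X := FinSubextCat.hom_ext (AlgHom.ext fun a => Subtype.ext (by
    change (Quotient.out (CosetCat.pt (𝟙 X)) : GalFbar F) (a : Fbar F) = a
    rw [PushCarrier.rep_apply_eq (𝟙 X) (g := 1) (by rw [CosetCat.pt_id]) (PushCarrier.out_pt_coe (𝟙 X)) a.2,
      AlgEquiv.one_apply]))
  map_comp {X Y Z} f h := FinSubextCat.hom_ext (AlgHom.ext fun a => Subtype.ext (by
    change (Quotient.out (CosetCat.pt (f ≫ h)) : GalFbar F) (a : Fbar F) =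
      (Quotient.out (CosetCat.pt f) : GalFbar F) ((Quotient.out (CosetCat.pt h) : GalFbar F) (a : Fbar F))
    have hrep : CosetCat.pt (f ≫ h) = (((Quotient.out (CosetCat.pt f) : GalFbar F) *
        (Quotient.out (CosetCat.pt h) : GalFbar F) : GalFbar F) : Z.carrier) := by
      rw [CosetCat.pt_comp]
      conv_lhs => rw [← PushCarrier.out_pt_coe f, CosetCat.toFun_coe, ← PushCarrier.out_pt_coe h,
        MulAction.Quotient.smul_coe, smul_eq_mul]
    rw [PushCarrier.rep_apply_eq (f ≫ h) hrep.symm (PushCarrier.out_pt_coe (f ≫ h)) a.2, AlgEquiv.mul_apply]))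

/-- Objects: `cosetFixedSubext F (G_F/V) = Spec F̄^V`. [cite: MochizukiFrdI2008, Ex. 6.3 p.113] -/
theorem cosetFixedSubext_obj_L (X : CosetCat (GalFbar F)) :
    ((cosetFixedSubext F).obj X).L = IntermediateField.fixedField (X.sg : Subgroup (GalFbar F)) := rfl

variable {F}

/-- **Arrows: `a ↦ g a` for ANY representative `g` of the point `f(1·U) = g·V`.** [cite: MochizukiFrdI2008, Ex. 6.3 p.113] -/
theorem cosetFixedSubext_map_apply {X Y : CosetCat (GalFbar F)} (f : X ⟶ Y) {g : GalFbar F}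
    (hg : (g : Y.carrier) = CosetCat.pt f) (a : ((cosetFixedSubext F).obj Y).L) :
    ((((cosetFixedSubext F).map f).toAlgHom a : ((cosetFixedSubext F).obj X).L) : Fbar F) = g (a : Fbar F) := by
  change (Quotient.out (CosetCat.pt f) : GalFbar F) (a : Fbar F) = g (a : Fbar F)
  exact PushCarrier.rep_apply_eq f hg (PushCarrier.out_pt_coe f) a.2

end FixedSubext

/-! ### §2 The tree's correspondence through CHOSEN base points is isomorphic to the canonical one -/

section BasePoint

variable {F : Type} [Field F] [PerfectField F] (hG : IsTempered (GalFbar F))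

omit [PerfectField F] in
/-- The base point of the coset object `G_F/V` (bridge `CosetCat.toConnected`) has a representative.
[cite: MochizukiFrdII2008, Ex 1.3 (i) p.11] -/
theorem PushCarrier.exists_rep_basePt (X : CosetCat (GalFbar F)) :
    ∃ x : GalFbar F, (x : X.carrier) = (basePt ((CosetCat.toConnected hG).obj X) : X.carrier) :=
  QuotientGroup.mk_surjective _

omit [PerfectField F] in
/-- The stabiliser of the base point `x·V` of `G_F/V` is `x V x⁻¹`: `σ` stabilises it iff `x⁻¹ σ x ∈ V`.
[cite: MochizukiFrdII2008, Ex 1.3 (i) p.11] -/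
theorem PushCarrier.mem_stabilizer_basePt_iff (X : CosetCat (GalFbar F)) {x : GalFbar F}
    (hx : (x : X.carrier) = (basePt ((CosetCat.toConnected hG).obj X) : X.carrier)) (σ : GalFbar F) :
    σ ∈ stabilizerSubgroup ((CosetCat.toConnected hG).obj X).obj (basePt ((CosetCat.toConnected hG).obj X)) ↔
      x⁻¹ * σ * x ∈ X.sg := by
  rw [mem_stabilizerSubgroup_iff, ← hx]
  change ((σ * x : GalFbar F) : X.carrier) = (x : X.carrier) ↔ _
  rw [eq_comm, QuotientGroup.eq, ← mul_assoc]
  rfl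

/-- Hence `F̄^{Stab(x·V)} = x · F̄^V`: `a ↦ x a` maps `F̄^V` into the field of `G_F/V`. [cite: MochizukiFrdI2008, Ex. 6.3 p.113] -/
theorem PushCarrier.rep_apply_mem_fixFld (X : CosetCat (GalFbar F)) {x : GalFbar F}
    (hx : (x : X.carrier) = (basePt ((CosetCat.toConnected hG).obj X) : X.carrier)) {a : Fbar F}
    (ha : a ∈ ((cosetFixedSubext F).obj X).L) : x a ∈ fixFld F ((CosetCat.toConnected hG).obj X) :=
  apply_mem_fixedField_of_conj_mem (fun σ hσ => (PushCarrier.mem_stabilizer_basePt_iff hG X hx σ).mp hσ) ha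

/-- … and `a ↦ x⁻¹ a` maps the field of `G_F/V` into `F̄^V`. [cite: MochizukiFrdI2008, Ex. 6.3 p.113] -/
theorem PushCarrier.inv_rep_apply_mem_fixedField (X : CosetCat (GalFbar F)) {x : GalFbar F}
    (hx : (x : X.carrier) = (basePt ((CosetCat.toConnected hG).obj X) : X.carrier)) {a : Fbar F}
    (ha : a ∈ fixFld F ((CosetCat.toConnected hG).obj X)) : x⁻¹ a ∈ ((cosetFixedSubext F).obj X).L := by
  refine apply_mem_fixedField_of_conj_mem (fun w hw => ?_) ha
  refine (PushCarrier.mem_stabilizer_basePt_iff hG X hx _).mpr ?_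
  rwa [inv_inv, show x⁻¹ * (x * w * x⁻¹) * x = w by group]

omit [PerfectField F] in
/-- **The field map of `f : G_F/U → G_F/V` through representatives** `x`, `y` of the base points and `c` of the point
`f(1·U) = c·V`: `F̄^{Stab(x_V)} → F̄^{Stab(x_U)}` is `a ↦ (x c y⁻¹) a`. [cite: MochizukiFrdII2008, Ex 1.3 (ii) p.11] -/
theorem PushCarrier.fieldMap_toConnected_apply {X Y : CosetCat (GalFbar F)} (f : X ⟶ Y) {x y c : GalFbar F}
    (hx : (x : X.carrier) = (basePt ((CosetCat.toConnected hG).obj X) : X.carrier))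
    (hy : (y : Y.carrier) = (basePt ((CosetCat.toConnected hG).obj Y) : Y.carrier))
    (hc : (c : Y.carrier) = CosetCat.pt f) (a : fixFld F ((CosetCat.toConnected hG).obj Y)) :
    (fieldMap ((CosetCat.toConnected hG).map f) a : Fbar F) = (x * c * y⁻¹) (a : Fbar F) := by
  apply fieldMap_apply_of_ρ_eq
  rw [← hx, ← hy]
  change ((x * c * y⁻¹ * y : GalFbar F) : Y.carrier) = CosetCat.Hom.toFun f (x : X.carrier)
  rw [CosetCat.toFun_coe, ← hc, MulAction.Quotient.smul_coe, smul_eq_mul, inv_mul_cancel_right]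

variable (F)

/-- **`CosetCat.toConnected ⋙ galoisSubext F ≅ cosetFixedSubext F`**: the Galois correspondence of the tree through
CHOSEN base points (`G_F/V ↦ Spec F̄^{Stab(x_V)}`, `x_V = g_V·V`) is naturally isomorphic to the canonical one
(`G_F/V ↦ Spec F̄^V`), by `a ↦ g_V a`; naturality: both ways round send `a ∈ F̄^{V'}` to `g_V c a` (`c·V'` the point of
`G_F/V → G_F/V'`). [cite: MochizukiFrdI2008, Ex. 6.3 p.113] -/
theorem nonempty_toConnected_galoisSubext_iso_cosetFixedSubext :
    Nonempty (CosetCat.toConnected hG ⋙ galoisSubext F ≅ cosetFixedSubext F) := by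
  choose x hx using PushCarrier.exists_rep_basePt hG (F := F)
  -- the component algebra maps `F̄^V → F̄^{Stab(x_V)}`, `a ↦ x a`, and back, `a ↦ x⁻¹ a`
  let ε : ∀ X : CosetCat (GalFbar F),
      ((cosetFixedSubext F).obj X).L →ₐ[F] ((CosetCat.toConnected hG ⋙ galoisSubext F).obj X).L :=
    fun X => restrictBetween (x X) _ _ fun _ ha => PushCarrier.rep_apply_mem_fixFld hG X (hx X) ha
  let ε' : ∀ X : CosetCat (GalFbar F),
      ((CosetCat.toConnected hG ⋙ galoisSubext F).obj X).L →ₐ[F] ((cosetFixedSubext F).obj X).L :=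
    fun X => restrictBetween (x X)⁻¹ _ _ fun _ ha => PushCarrier.inv_rep_apply_mem_fixedField hG X (hx X) ha
  let e : ∀ X : CosetCat (GalFbar F),
      (CosetCat.toConnected hG ⋙ galoisSubext F).obj X ≅ (cosetFixedSubext F).obj X := fun X =>
    { hom := ⟨ε X⟩
      inv := ⟨ε' X⟩
      hom_inv_id := FinSubextCat.hom_ext (AlgHom.ext fun a => Subtype.ext (by
        change x X ((x X)⁻¹ (a : Fbar F)) = a
        rw [← AlgEquiv.mul_apply, mul_inv_cancel, AlgEquiv.one_apply]))
      inv_hom_id := FinSubextCat.hom_ext (AlgHom.ext fun a => Subtype.ext (by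
        change (x X)⁻¹ (x X (a : Fbar F)) = a
        rw [← AlgEquiv.mul_apply, inv_mul_cancel, AlgEquiv.one_apply])) }
  refine ⟨NatIso.ofComponents e fun {X Y} f => ?_⟩
  obtain ⟨c, hc⟩ := QuotientGroup.mk_surjective (CosetCat.pt f)
  apply FinSubextCat.hom_ext
  refine AlgHom.ext fun a => Subtype.ext ?_
  change (fieldMap ((CosetCat.toConnected hG).map f) (ε Y a) : Fbar F) =
    x X ((((cosetFixedSubext F).map f).toAlgHom a : ((cosetFixedSubext F).obj X).L) : Fbar F)
  rw [PushCarrier.fieldMap_toConnected_apply hG f (hx X) (hx Y) hc, cosetFixedSubext_map_apply f hc,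
    ← AlgEquiv.mul_apply]
  change (x X * c * (x Y)⁻¹) (x Y (a : Fbar F)) = _
  rw [← AlgEquiv.mul_apply, inv_mul_cancel_right]

end BasePoint

end Literature.IUT.HodgeTheaters

end
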